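import Mathlib
import HarnessLib
import Summits.ValiantsHypothesis.ValiantsHypothesis.Theses.MonotoneRestoration
import Literature.Computability.AlgebraicComplexity.ArithCircuit
import Literature.Computability.AlgebraicComplexity.ArithCircuitProofs
import Literature.Computability.AlgebraicComplexity.MonotoneStructure
import Literature.Computability.AlgebraicComplexity.PermanentIrreducible
import Literature.ModelTheory.FiniteModelTheory.CkEquiv
import Summits.ValiantsHypothesis.ValiantsHypothesis.Theorems.MonotoneRestorationMonotoneRestorationQPCosetCount
import Summits.ValiantsHypothesis.ValiantsHypothesis.Theorems.MonotoneRestorationMonotoneRestorationQPSymmetricLB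
import Summits.ValiantsHypothesis.ValiantsHypothesis.Theorems.MonotoneRestorationMonotoneRestorationQPSupportSymmetrisation
import Summits.ValiantsHypothesis.ValiantsHypothesis.Theorems.MonotoneRestorationMonotoneRestorationQPSparseRegime
import Summits.ValiantsHypothesis.ValiantsHypothesis.Theorems.MonotoneRestorationMonotoneRestorationQPBeta
import Literature.Computability.AlgebraicComplexity.SymmetricArithCircuit
import Literature.Computability.AlgebraicComplexity.DawarWilsenach2025Proofs
import Literature.GroupTheory.PermutationGroups.SmallIndexSubgroups
import Summits.ValiantsHypothesis.ValiantsHypothesis.Theorems.MonotoneRestorationQP.Negative.LoadBearing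
import Summits.ValiantsHypothesis.ValiantsHypothesis.Theorems.MonotoneRestorationMonotoneRestorationQPPermSupportCount

/-! TTRL-lite variant V19240 of stmt-ValiantsHypothesis-15886

Target `stub_esymmRowSums_complexity`, move `lemma_proposal` (multi-output bookkeeping ⇒
single-output measure): if `f` is among the values of a fan-in-two gate LIST `gs`, then
`complexity f ≤ gs.length` — read `f` at its index `i` (`List.getElem_of_mem`), take the circuit
`⟨gs, .gate i⟩`, and apply the defining inequality `ArithCircuit.complexity_le_size`.  This is the
step that lets a dynamic programme share the gates computing `e_0, …, e_d` across rows.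
-/

-- `Summit.ValiantsHypothesis.ValiantsHypothesis.…` is the tree's mandated single-conjunct layout
-- (Sub = Summit), so the duplicated namespace component is intended.
set_option linter.dupNamespace false

namespace Summit.ValiantsHypothesis.ValiantsHypothesis.Theorems

open Summit.ValiantsHypothesis.ValiantsHypothesis.Theses.MonotoneRestoration
open Literature.Computability.AlgebraicComplexity

/-- TTRL-lite variant V19240 of `stmt-ValiantsHypothesis-15886` (multi-output bookkeeping): a
fan-in-two gate list `gs` that has `f` among its gate values witnesses `complexity f ≤ |gs|`,
via the circuit with gates `gs` and output operand `gate i` where `(gateValues gs)[i] = f`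
(`ArithCircuit.complexity_le_size`). [cite: Burgisser2000, Def. 2.1] -/
theorem stub_esymmRowSums_complexity_var19240 :
    ∀ (σ : Type) (gs : List (ArithCircuit.Gate NNReal σ)) (f : MvPolynomial σ NNReal),
      (∀ g ∈ gs, g.fanIn ≤ 2) → f ∈ ArithCircuit.gateValues gs → complexity f ≤ gs.length := by
  intro σ gs f hfan hf
  obtain ⟨i, hi, rfl⟩ := List.getElem_of_mem hf
  have hcomp : (⟨gs, .gate i⟩ : ArithCircuit NNReal σ).Computes (ArithCircuit.gateValues gs)[i] := by
    show ArithCircuit.Operand.eval (ArithCircuit.gateValues gs) (.gate i) = _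
    simp [ArithCircuit.Operand.eval, List.getD_eq_getElem?_getD, List.getElem?_eq_getElem hi]
  exact ArithCircuit.complexity_le_size (P := ⟨gs, .gate i⟩) hfan hcomp

end Summit.ValiantsHypothesis.ValiantsHypothesis.Theorems
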